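import Summits.CriticalPhenomena.PercolationContinuityZ3.Theorems.Transplant.SkelNegBParamsReachFC
import HarnessLib

/-!
# N1 params, chain of record `NegB`, part RootArith: THE INTEGER ARITHMETIC OF THE ROOT RUN'S FINE READINGS — generic lemmas (no ledger objects) that
# discharge the (c)-block of p3's root residue (`hPf₁/hPf₂/hPf₃`, `hLg₁/hLg₂/hLg₃` of `rootOblTWAt_negBS*_x`) once the values are plugged in

Units: `u := Kq·s₀` (one long stride in fine units along the cells' axis 0; `c₀ = 20K s₀ = 800u`, `r₀ = 40u`, `b0T₀ = 10u`), `m` the lattice modulus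
(`D = 800²·m`), `n = n_L`, `su = n_L + |h_L|`, `v = v_L`, `W·su ≤ n_Lℓ_L + su` (window), `Lb·su ≤ 3n_Lℓ_L + su` (link box), `RA = RA′`, `q = qB`, `N = Nr`,
`Λ := v_β·yL₀ − v_L·yL₁` (so `lam0 800 v_L v_β yL = 800Λ`), and for axis 1 `u := Kq·s₁`, `Λ := n_L·yL₁ − h_L·yL₀`.
The reductions: `coarse (800u) (D/2) D (800Λ) = ⌊(2uΛ + m)/2m⌋` (`coarse_bounds`), the along increment `⌊800u·⌊800(m·a − B)/n⌋/D⌋ ≈ u·a/n − u·B/(nm)`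
(`incr_bounds`), the transverse increment `⌊800u·800X/D⌋ = ⌊uX/m⌋` (`trans_bounds`); the window terms `|B| ≤ |v|·su·(L+1)` (`B_bounds`) with
`2|B| ≤ 3mn` over the last core and `≤ 9mn` over the prism (`prism_B`) at the floors `2000(RA′+2) ≤ n_L`, `22000(RA′+2) ≤ ℓ_L`, `4q ≤ n_L`, `N+1 ≤ 1000`.
RESULTS (each in the literal shape of p3's hypothesis after the values are substituted): **`along_pos` / `along_neg`** (the last core lands in the target box
`20r₀ ± (b0T₀ − 1)` along the run axis, `σ = ±1`, from the centring `|F + σu(N+1) − σ·800u| ≤ u` of `N`), **`trans_last`** (across: `±(b0T₁ − 1)`, from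
`|Λ₁| ≤ 2m`), (part RootArithP: `prism_pos` / `prism_neg` / `trans_prism` — the run prism inside the root world).

builds on p205010 (kernel theorem, internal audit signed; external expert review pending) — nothing in this file uses p205010; NOTHING is claimed about
the node `SamePDropOfSkeletonNeg₁` (OPEN).  Pure arithmetic; no definitions.
Lane `prim-bschramm-*`, seat `prim-bschramm-stmt` (gen 14); helper file (`--supports stmt-CriticalPhenomena-4575 --as helper`); ledger HOME/prim-bschramm-stmt/NEG-PARAMS.md v0.13.
[cite: KozmaNitzan2024, §4 p. 28 ((32) at the root), Lemma 11 (p. 22: the target boxes)] [cite: MartineauTassion2017, §4.3 Lemma 4.2]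
-/

namespace Summit.CriticalPhenomena.PercolationContinuityZ3.Theorems.Transplant

namespace PlanarSkeletonNeg

namespace NegB

namespace RootArith

/-- Floor sandwich: `d·(x/d) ≤ x < d·(x/d) + d`. [folklore] -/
theorem floor_sandwich {x d : ℤ} (hd : 0 < d) : d * (x / d) ≤ x ∧ x < d * (x / d) + d :=
  ⟨Int.mul_ediv_self_le hd.ne', by have := Int.lt_mul_ediv_self_add (x := x) hd; linarith⟩

/-- The fine coordinate of the run origin `F := (800u·(800Λ) + D/2)/D`, `D = 640000m`: `2mF ≤ 2uΛ + m < 2mF + 2m`. [folklore] -/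
theorem coarse_bounds {u m Λ : ℤ} (hm : 0 < m) :
    2 * m * ((800 * u * (800 * Λ) + 640000 * m / 2) / (640000 * m)) ≤ 2 * u * Λ + m ∧
      2 * u * Λ + m < 2 * m * ((800 * u * (800 * Λ) + 640000 * m / 2) / (640000 * m)) + 2 * m := by
  have hD : (0 : ℤ) < 640000 * m := by positivity
  have h2 : (640000 * m / 2 : ℤ) = 320000 * m := by omega
  rw [h2]
  obtain ⟨h1, h3⟩ := floor_sandwich (x := 800 * u * (800 * Λ) + 320000 * m) hD
  set F := (800 * u * (800 * Λ) + 320000 * m) / (640000 * m)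
  constructor <;> nlinarith

/-- The along increment `G := (800u·((800(ma − B))/n))/(640000m)`: `mnG ≤ u(ma − B)` and `800u(ma − B) − un − 800mn ≤ 800mnG`. [folklore] -/
theorem incr_bounds {u m n a B : ℤ} (hu : 0 ≤ u) (hm : 0 < m) (hn : 0 < n) :
    m * n * ((800 * u * (800 * (m * a - B) / n)) / (640000 * m)) ≤ u * (m * a - B) ∧
      800 * u * (m * a - B) - u * n - 800 * m * n ≤ 800 * m * n * ((800 * u * (800 * (m * a - B) / n)) / (640000 * m)) := by
  have hD : (0 : ℤ) < 640000 * m := by positivity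
  obtain ⟨i1, i2⟩ := floor_sandwich (x := 800 * (m * a - B)) hn
  set I := 800 * (m * a - B) / n
  obtain ⟨g1, g2⟩ := floor_sandwich (x := 800 * u * I) hD
  set G := 800 * u * I / (640000 * m)
  constructor
  · -- 640000 m G ≤ 800 u I and n I ≤ 800(ma − B) ⇒ 640000 m n G ≤ 800 u n I ≤ 800 u · 800 (ma − B)
    have h1 : 640000 * m * n * G ≤ 800 * u * (n * I) := by nlinarith
    have h2 : 800 * u * (n * I) ≤ 800 * u * (800 * (m * a - B)) := by nlinarith
    nlinarith
  · have h1 : 800 * u * (n * I) < 640000 * m * n * G + 640000 * m * n := by nlinarith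
    have h2 : 800 * u * (800 * (m * a - B)) < 800 * u * (n * I) + 800 * u * n ∨ u = 0 := by
      rcases eq_or_lt_of_le hu with h | h
      · right; exact h.symm
      · left; nlinarith
    rcases h2 with h2 | h2
    · nlinarith
    · subst h2
      simp only [mul_zero, zero_mul, zero_sub, sub_zero] at g1 g2 ⊢
      nlinarith

/-- The transverse term `H := (800u·(800X))/(640000m) = ⌊uX/m⌋`: `mH ≤ uX < mH + m`. [folklore] -/
theorem trans_bounds {u m X : ℤ} (hm : 0 < m) :
    m * ((800 * u * (800 * X)) / (640000 * m)) ≤ u * X ∧ u * X < m * ((800 * u * (800 * X)) / (640000 * m)) + m := by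
  have e : 800 * u * (800 * X) = 640000 * (u * X) := by ring
  rw [e, show (640000 : ℤ) * m = 640000 * m from rfl, Int.mul_ediv_mul_of_pos _ _ (by norm_num : (0:ℤ) < 640000)]
  exact floor_sandwich hm



/-- The window terms: `|max (v(su(−L−1))) (v(suL + su − 1))|`, `|min …| ≤ |v|·su·(L+1)`. [folklore] -/
theorem B_bounds {v su L : ℤ} (hsu : 1 ≤ su) (hL : 0 ≤ L) :
    |max (v * (su * (-L - 1))) (v * (su * L + su - 1))| ≤ |v| * (su * (L + 1)) ∧
      |min (v * (su * (-L - 1))) (v * (su * L + su - 1))| ≤ |v| * (su * (L + 1)) := by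
  have h1 : |v * (su * (-L - 1))| ≤ |v| * (su * (L + 1)) := by
    rw [abs_mul]; refine mul_le_mul_of_nonneg_left ?_ (abs_nonneg v)
    rw [abs_le]; constructor <;> nlinarith
  have h2 : |v * (su * L + su - 1)| ≤ |v| * (su * (L + 1)) := by
    rw [abs_mul]; refine mul_le_mul_of_nonneg_left ?_ (abs_nonneg v)
    rw [abs_le]; constructor <;> nlinarith
  obtain ⟨a1, a2⟩ := abs_le.1 h1
  obtain ⟨b1, b2⟩ := abs_le.1 h2
  constructor
  · rw [abs_le]; constructor
    · exact le_trans a1 (le_max_left _ _)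
    · exact max_le a2 b2
  · rw [abs_le]; constructor
    · exact le_min a1 b1
    · exact le_trans (min_le_left _ _) a2

/-- **ALONG, `σ = 1`**: the last core's fine reading lands in `[790u + 1, 810u − 1] = [20r₀ − b0T₀ + 1, 20r₀ + b0T₀ − 1]`.
[cite: KozmaNitzan2024, §4 Lemma 11 (p. 22)] -/
theorem along_pos {u m n su v ℓ W RA q N Λ : ℤ} (hu : 1 ≤ u) (hn : 1 ≤ n) (hm : n * (ℓ - 1) < m) (hsu : n ≤ su) (hsu' : su ≤ 11 * n)
    (hv : |v| ≤ n) (hW : su * W ≤ n * ℓ + su) (hW0 : 0 ≤ W) (hRA : 0 ≤ RA) (hRAn : 2000 * (RA + 2) ≤ n) (hRAℓ : 22000 * (RA + 2) ≤ ℓ)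
    (hq : 0 ≤ q) (hq' : 4 * q ≤ n) (hN : 0 ≤ N) (hN' : N + 1 ≤ 1000)
    (hcen : |(800 * u * (800 * Λ) + 640000 * m / 2) / (640000 * m) + u * (N + 1) - 800 * u| ≤ u) :
    800 * u - 10 * u + 1 ≤ (800 * u * (800 * Λ) + 640000 * m / 2) / (640000 * m) +
        (800 * u * (800 * (m * (min (1 * ((N + 1) * n - q - (N + 1) * RA)) (1 * ((N + 1) * n + q + (N + 1) * RA))) -
          max (v * (su * (min (1 * (-(W + (N + 1) * RA))) (1 * (W + (N + 1) * RA)) - 1))) (v * (su * (max (1 * (-(W + (N + 1) * RA))) (1 * (W + (N + 1) * RA))) + su - 1))) / n)) /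
          (640000 * m) ∧
      (800 * u * (800 * Λ) + 640000 * m / 2) / (640000 * m) +
        (800 * u * (800 * (m * (max (1 * ((N + 1) * n - q - (N + 1) * RA)) (1 * ((N + 1) * n + q + (N + 1) * RA))) -
          min (v * (su * (min (1 * (-(W + (N + 1) * RA))) (1 * (W + (N + 1) * RA)) - 1))) (v * (su * (max (1 * (-(W + (N + 1) * RA))) (1 * (W + (N + 1) * RA))) + su - 1))) / n)) /
          (640000 * m) + 1 ≤ 800 * u + 10 * u - 1 := by
  have hm0 : 0 < m := by nlinarith
  have hn0 : 0 < n := by linarith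
  have hu0 : 0 ≤ u := by linarith
  set Fc := (800 * u * (800 * Λ) + 640000 * m / 2) / (640000 * m)
  set L := W + (N + 1) * RA with hLdef
  have hL0 : 0 ≤ L := by rw [hLdef]; positivity
  have hqr : 4 * (q + (N + 1) * RA) ≤ 3 * n := by nlinarith
  have hNR : 0 ≤ (N + 1) * RA := by positivity
  simp only [one_mul]
  rw [min_eq_left (by linarith : (N + 1) * n - q - (N + 1) * RA ≤ (N + 1) * n + q + (N + 1) * RA),
    max_eq_right (by linarith : (N + 1) * n - q - (N + 1) * RA ≤ (N + 1) * n + q + (N + 1) * RA),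
    min_eq_left (by linarith : -L ≤ L), max_eq_right (by linarith : -L ≤ L)]
  obtain ⟨hBmax, hBmin⟩ := B_bounds (v := v) (su := su) (L := L) (by linarith) hL0
  set Bmax := max (v * (su * (-L - 1))) (v * (su * L + su - 1))
  set Bmin := min (v * (su * (-L - 1))) (v * (su * L + su - 1))
  -- `su(L+1) ≤ nℓ + 22n + 11000·n·RA` and `2|B| ≤ 3mn`
  have hℓ0 : 0 ≤ ℓ := by linarith
  have hsu0 : 0 ≤ su := by linarith
  have hsuL : su * (L + 1) ≤ n * ℓ + 22 * n + 11000 * n * RA := by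
    have h0 : (N + 1) * RA ≤ 1000 * RA := mul_le_mul_of_nonneg_right hN' hRA
    have h1 : su * ((N + 1) * RA) ≤ (11 * n) * (1000 * RA) := mul_le_mul hsu' h0 hNR (by positivity)
    rw [hLdef]; linarith
  have hvs : |v| * (su * (L + 1)) ≤ n * (n * ℓ + 22 * n + 11000 * n * RA) :=
    mul_le_mul hv hsuL (by positivity) (by positivity)
  have h3m : 2 * (n * (n * ℓ + 22 * n + 11000 * n * RA)) ≤ 3 * m * n := by
    have hℓ' : 47 + 22000 * RA ≤ ℓ := by linarith
    have h1 := mul_le_mul_of_nonneg_left hℓ' hn0.le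
    have h2X : 2 * (n * ℓ + 22 * n + 11000 * n * RA) ≤ 3 * m := by linarith
    have h3 := mul_le_mul_of_nonneg_left h2X hn0.le
    linarith
  have hBx : 2 * |Bmax| ≤ 3 * m * n := by linarith
  have hBn : 2 * |Bmin| ≤ 3 * m * n := by linarith
  have hcen' := abs_le.1 hcen
  constructor
  · obtain ⟨-, g2⟩ := incr_bounds (u := u) (m := m) (n := n) (a := (N + 1) * n - q - (N + 1) * RA) (B := Bmax) hu0 hm0 hn0
    set G := 800 * u * (800 * (m * ((N + 1) * n - q - (N + 1) * RA) - Bmax) / n) / (640000 * m)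
    have e1 : u * (4 * (m * ((N + 1) * n - q - (N + 1) * RA))) ≥ u * (4 * m * n * (N + 1) - 3 * m * n) := by
      refine mul_le_mul_of_nonneg_left ?_ hu0
      have := mul_le_mul_of_nonneg_left hqr hm0.le
      linarith
    have e2 : 2 * (u * Bmax) ≤ 3 * u * m * n := by
      have h1 : u * Bmax ≤ u * |Bmax| := mul_le_mul_of_nonneg_left (le_abs_self _) hu0
      have h2 := mul_le_mul_of_nonneg_left hBx hu0
      linarith
    have key : 800 * m * n * (G - u * (N + 1) + 3 * u + 1) ≥ 600 * u * m * n - u * n := by linarith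
    have hX : 0 ≤ G - u * (N + 1) + 3 * u + 1 := by
      by_contra hc
      push Not at hc
      have h1 : 800 * m * n * (G - u * (N + 1) + 3 * u + 1) ≤ 800 * m * n * (-1) := mul_le_mul_of_nonneg_left (by linarith) (by positivity)
      have h2 : 0 ≤ u * n * (600 * m - 1) := mul_nonneg (mul_nonneg hu0 hn0.le) (by linarith)
      have hmn : 0 < m * n := mul_pos hm0 hn0
      nlinarith
    linarith
  · obtain ⟨g1, -⟩ := incr_bounds (u := u) (m := m) (n := n) (a := (N + 1) * n + q + (N + 1) * RA) (B := Bmin) hu0 hm0 hn0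
    set G := 800 * u * (800 * (m * ((N + 1) * n + q + (N + 1) * RA) - Bmin) / n) / (640000 * m)
    have e1 : u * (4 * (m * ((N + 1) * n + q + (N + 1) * RA))) ≤ u * (4 * m * n * (N + 1) + 3 * m * n) := by
      refine mul_le_mul_of_nonneg_left ?_ hu0
      have := mul_le_mul_of_nonneg_left hqr hm0.le
      linarith
    have e2 : 2 * (u * (-Bmin)) ≤ 3 * u * m * n := by
      have h1 : u * (-Bmin) ≤ u * |Bmin| := mul_le_mul_of_nonneg_left (neg_le_abs _) hu0
      have h2 := mul_le_mul_of_nonneg_left hBn hu0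
      linarith
    have key : 4 * (m * n * G) ≤ 4 * u * m * n * (N + 1) + 9 * u * m * n := by linarith
    have hX : G ≤ u * (N + 1) + 3 * u - 1 := by
      by_contra hc
      push Not at hc
      have h1 : 4 * (m * n) * (u * (N + 1) + 3 * u) ≤ 4 * (m * n) * G := mul_le_mul_of_nonneg_left (by linarith) (by positivity)
      have h2 : 0 < u * m * n := mul_pos (mul_pos (by linarith) hm0) hn0
      nlinarith
    linarith



/-- **ALONG, `σ = −1`** (mirror: `790u + 1 ≤ −LHI`, `−LLO ≤ 810u − 1`). [cite: KozmaNitzan2024, §4 Lemma 11 (p. 22)] -/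
theorem along_neg {u m n su v ℓ W RA q N Λ : ℤ} (hu : 1 ≤ u) (hn : 1 ≤ n) (hm : n * (ℓ - 1) < m) (hsu : n ≤ su) (hsu' : su ≤ 11 * n)
    (hv : |v| ≤ n) (hW : su * W ≤ n * ℓ + su) (hW0 : 0 ≤ W) (hRA : 0 ≤ RA) (hRAn : 2000 * (RA + 2) ≤ n) (hRAℓ : 22000 * (RA + 2) ≤ ℓ)
    (hq : 0 ≤ q) (hq' : 4 * q ≤ n) (hN : 0 ≤ N) (hN' : N + 1 ≤ 1000)
    (hcen : |(800 * u * (800 * Λ) + 640000 * m / 2) / (640000 * m) - u * (N + 1) + 800 * u| ≤ u) :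
    800 * u - 10 * u + 1 ≤ -((800 * u * (800 * Λ) + 640000 * m / 2) / (640000 * m) +
        (800 * u * (800 * (m * (max ((-1) * ((N + 1) * n - q - (N + 1) * RA)) ((-1) * ((N + 1) * n + q + (N + 1) * RA))) -
          min (v * (su * (min ((-1) * (-(W + (N + 1) * RA))) ((-1) * (W + (N + 1) * RA)) - 1))) (v * (su * (max ((-1) * (-(W + (N + 1) * RA))) ((-1) * (W + (N + 1) * RA))) + su - 1))) / n)) /
          (640000 * m) + 1) ∧
      -((800 * u * (800 * Λ) + 640000 * m / 2) / (640000 * m) +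
        (800 * u * (800 * (m * (min ((-1) * ((N + 1) * n - q - (N + 1) * RA)) ((-1) * ((N + 1) * n + q + (N + 1) * RA))) -
          max (v * (su * (min ((-1) * (-(W + (N + 1) * RA))) ((-1) * (W + (N + 1) * RA)) - 1))) (v * (su * (max ((-1) * (-(W + (N + 1) * RA))) ((-1) * (W + (N + 1) * RA))) + su - 1))) / n)) /
          (640000 * m)) ≤ 800 * u + 10 * u - 1 := by
  have hm0 : 0 < m := by nlinarith
  have hn0 : 0 < n := by linarith
  have hu0 : 0 ≤ u := by linarith
  set Fc := (800 * u * (800 * Λ) + 640000 * m / 2) / (640000 * m)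
  set L := W + (N + 1) * RA with hLdef
  have hL0 : 0 ≤ L := by rw [hLdef]; positivity
  have hqr : 4 * (q + (N + 1) * RA) ≤ 3 * n := by nlinarith
  have hNR : 0 ≤ (N + 1) * RA := by positivity
  simp only [neg_mul, one_mul, neg_neg]
  rw [max_eq_left (by linarith : -((N + 1) * n + q + (N + 1) * RA) ≤ -((N + 1) * n - q - (N + 1) * RA)),
    min_eq_right (by linarith : -((N + 1) * n + q + (N + 1) * RA) ≤ -((N + 1) * n - q - (N + 1) * RA)),
    min_eq_right (by linarith : -L ≤ L), max_eq_left (by linarith : -L ≤ L)]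
  obtain ⟨hBmax, hBmin⟩ := B_bounds (v := v) (su := su) (L := L) (by linarith) hL0
  set Bmax := max (v * (su * (-L - 1))) (v * (su * L + su - 1))
  set Bmin := min (v * (su * (-L - 1))) (v * (su * L + su - 1))
  have hℓ0 : 0 ≤ ℓ := by linarith
  have hsu0 : 0 ≤ su := by linarith
  have hsuL : su * (L + 1) ≤ n * ℓ + 22 * n + 11000 * n * RA := by
    have h0 : (N + 1) * RA ≤ 1000 * RA := mul_le_mul_of_nonneg_right hN' hRA
    have h1 : su * ((N + 1) * RA) ≤ (11 * n) * (1000 * RA) := mul_le_mul hsu' h0 hNR (by positivity)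
    rw [hLdef]; linarith
  have hvs : |v| * (su * (L + 1)) ≤ n * (n * ℓ + 22 * n + 11000 * n * RA) :=
    mul_le_mul hv hsuL (by positivity) (by positivity)
  have h3m : 2 * (n * (n * ℓ + 22 * n + 11000 * n * RA)) ≤ 3 * m * n := by
    have hℓ' : 47 + 22000 * RA ≤ ℓ := by linarith
    have h1 := mul_le_mul_of_nonneg_left hℓ' hn0.le
    have h2X : 2 * (n * ℓ + 22 * n + 11000 * n * RA) ≤ 3 * m := by linarith
    have h3 := mul_le_mul_of_nonneg_left h2X hn0.le
    linarith
  have hBx : 2 * |Bmax| ≤ 3 * m * n := by linarith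
  have hBn : 2 * |Bmin| ≤ 3 * m * n := by linarith
  have hcen' := abs_le.1 hcen
  constructor
  · -- `−LHI ≥ 790u + 1`: G' := G(−laLo, Bmin) ≤ −u(N+1) + 3u − 1
    obtain ⟨g1, -⟩ := incr_bounds (u := u) (m := m) (n := n) (a := -((N + 1) * n - q - (N + 1) * RA)) (B := Bmin) hu0 hm0 hn0
    set G := 800 * u * (800 * (m * -((N + 1) * n - q - (N + 1) * RA) - Bmin) / n) / (640000 * m)
    have e1 : u * (4 * (m * -((N + 1) * n - q - (N + 1) * RA))) ≤ u * (-(4 * m * n * (N + 1)) + 3 * m * n) := by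
      refine mul_le_mul_of_nonneg_left ?_ hu0
      have := mul_le_mul_of_nonneg_left hqr hm0.le
      linarith
    have e2 : 2 * (u * (-Bmin)) ≤ 3 * u * m * n := by
      have h1 : u * (-Bmin) ≤ u * |Bmin| := mul_le_mul_of_nonneg_left (neg_le_abs _) hu0
      have h2 := mul_le_mul_of_nonneg_left hBn hu0
      linarith
    have key : 4 * (m * n * G) ≤ -(4 * u * m * n * (N + 1)) + 9 * u * m * n := by linarith
    have hX : G ≤ -(u * (N + 1)) + 3 * u - 1 := by
      by_contra hc
      push Not at hc
      have h1 : 4 * (m * n) * (-(u * (N + 1)) + 3 * u) ≤ 4 * (m * n) * G := mul_le_mul_of_nonneg_left (by linarith) (by positivity)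
      have h2 : 0 < u * m * n := mul_pos (mul_pos (by linarith) hm0) hn0
      nlinarith
    linarith
  · -- `−LLO ≤ 810u − 1`: G := G(−laHi, Bmax) ≥ −u(N+1) − 3u − 1
    obtain ⟨-, g2⟩ := incr_bounds (u := u) (m := m) (n := n) (a := -((N + 1) * n + q + (N + 1) * RA)) (B := Bmax) hu0 hm0 hn0
    set G := 800 * u * (800 * (m * -((N + 1) * n + q + (N + 1) * RA) - Bmax) / n) / (640000 * m)
    have e1 : u * (4 * (m * -((N + 1) * n + q + (N + 1) * RA))) ≥ u * (-(4 * m * n * (N + 1)) - 3 * m * n) := by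
      refine mul_le_mul_of_nonneg_left ?_ hu0
      have := mul_le_mul_of_nonneg_left hqr hm0.le
      linarith
    have e2 : 2 * (u * Bmax) ≤ 3 * u * m * n := by
      have h1 : u * Bmax ≤ u * |Bmax| := mul_le_mul_of_nonneg_left (le_abs_self _) hu0
      have h2 := mul_le_mul_of_nonneg_left hBx hu0
      linarith
    have key : 800 * m * n * (G + u * (N + 1) + 3 * u + 1) ≥ 600 * u * m * n - u * n := by linarith
    have hX : 0 ≤ G + u * (N + 1) + 3 * u + 1 := by
      by_contra hc
      push Not at hc
      have h1 : 800 * m * n * (G + u * (N + 1) + 3 * u + 1) ≤ 800 * m * n * (-1) := mul_le_mul_of_nonneg_left (by linarith) (by positivity)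
      have h2 : 0 ≤ u * n * (600 * m - 1) := mul_nonneg (mul_nonneg hu0 hn0.le) (by linarith)
      have hmn : 0 < m * n := mul_pos hm0 hn0
      nlinarith
    linarith

/-- **ACROSS (last core), either `σ`**: `−(10u − 1) ≤ LLO₁`, `LHI₁ ≤ 10u − 1` (`u = Kq·s₁`, `|Λ₁| ≤ 2m`). [cite: KozmaNitzan2024, §4 Lemma 11 (p. 22)] -/
theorem trans_last {u m n su ℓ W RA N Λ σ : ℤ} (hu : 1 ≤ u) (hn : 1 ≤ n) (hm : n * (ℓ - 1) < m) (hsu : n ≤ su) (hsu' : su ≤ 11 * n)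
    (hW : su * W ≤ n * ℓ + su) (hW0 : 0 ≤ W) (hRA : 0 ≤ RA) (hRAℓ : 22000 * (RA + 2) ≤ ℓ) (hN : 0 ≤ N) (hN' : N + 1 ≤ 1000)
    (hσ : σ = 1 ∨ σ = -1) (hΛ : |Λ| ≤ 2 * m) :
    -(10 * u - 1) ≤ (800 * u * (800 * Λ) + 640000 * m / 2) / (640000 * m) +
        (800 * u * (800 * (su * (min (σ * (-(W + (N + 1) * RA))) (σ * (W + (N + 1) * RA)) - 1)))) / (640000 * m) ∧
      (800 * u * (800 * Λ) + 640000 * m / 2) / (640000 * m) +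
        (800 * u * (800 * (su * (max (σ * (-(W + (N + 1) * RA))) (σ * (W + (N + 1) * RA))) + su - 1))) / (640000 * m) + 1 ≤ 10 * u - 1 := by
  have hm0 : 0 < m := by nlinarith
  have hn0 : 0 < n := by linarith
  have hu0 : 0 ≤ u := by linarith
  set L := W + (N + 1) * RA with hLdef
  have hNR : 0 ≤ (N + 1) * RA := by positivity
  have hL0 : 0 ≤ L := by rw [hLdef]; positivity
  have hmin : min (σ * -L) (σ * L) = -L := by
    rcases hσ with rfl | rfl
    · simp only [one_mul]; exact min_eq_left (by linarith)
    · simp only [neg_mul, one_mul, neg_neg]; exact min_eq_right (by linarith)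
  have hmax : max (σ * -L) (σ * L) = L := by
    rcases hσ with rfl | rfl
    · simp only [one_mul]; exact max_eq_right (by linarith)
    · simp only [neg_mul, one_mul, neg_neg]; exact max_eq_left (by linarith)
  rw [hmin, hmax]
  obtain ⟨f1, f2⟩ := coarse_bounds (u := u) (Λ := Λ) hm0
  set F := (800 * u * (800 * Λ) + 640000 * m / 2) / (640000 * m)
  obtain ⟨hΛ1, hΛ2⟩ := abs_le.1 hΛ
  have hF : -2 * u ≤ F ∧ F ≤ 2 * u := by
    constructor
    · by_contra hc; push Not at hc
      have h1 : 2 * m * F ≤ 2 * m * (-2 * u - 1) := mul_le_mul_of_nonneg_left (by linarith) (by positivity)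
      nlinarith
    · by_contra hc; push Not at hc
      have h1 : 2 * m * (2 * u + 1) ≤ 2 * m * F := mul_le_mul_of_nonneg_left (by linarith) (by positivity)
      nlinarith
  have hℓ0 : 0 ≤ ℓ := by linarith
  have hsu0 : 0 ≤ su := by linarith
  have hsuL : su * (L + 1) ≤ n * ℓ + 22 * n + 11000 * n * RA := by
    have h0 : (N + 1) * RA ≤ 1000 * RA := mul_le_mul_of_nonneg_right hN' hRA
    have h1 : su * ((N + 1) * RA) ≤ (11 * n) * (1000 * RA) := mul_le_mul hsu' h0 hNR (by positivity)
    rw [hLdef]; linarith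
  have h2X : 2 * (n * ℓ + 22 * n + 11000 * n * RA) ≤ 3 * m := by
    have hℓ' : 47 + 22000 * RA ≤ ℓ := by linarith
    have h1 := mul_le_mul_of_nonneg_left hℓ' hn0.le
    linarith
  have hsL : 2 * (su * (L + 1)) ≤ 3 * m := by linarith
  constructor
  · obtain ⟨-, t2⟩ := trans_bounds (u := u) (m := m) (X := su * (-L - 1)) hm0
    set H := 800 * u * (800 * (su * (-L - 1))) / (640000 * m)
    -- u·su·(−L−1) ≥ −(3/2) u m ⇒ H ≥ −2u … : m H > u X − m ≥ −(3/2)um − m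
    have e : 2 * (u * (su * (-L - 1))) ≥ -(3 * u * m) := by
      have := mul_le_mul_of_nonneg_left hsL hu0; linarith
    have hX : -2 * u - 1 ≤ H := by
      by_contra hc; push Not at hc
      have h1 : m * H ≤ m * (-2 * u - 2) := mul_le_mul_of_nonneg_left (by linarith) hm0.le
      nlinarith
    linarith
  · obtain ⟨t1, -⟩ := trans_bounds (u := u) (m := m) (X := su * L + su - 1) hm0
    set H := 800 * u * (800 * (su * L + su - 1)) / (640000 * m)
    have e : 2 * (u * (su * L + su - 1)) ≤ 3 * u * m := by
      have := mul_le_mul_of_nonneg_left hsL hu0; nlinarith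
    have hX : H ≤ 2 * u := by
      by_contra hc; push Not at hc
      have h1 : m * (2 * u + 1) ≤ m * H := mul_le_mul_of_nonneg_left (by linarith) hm0.le
      nlinarith
    linarith




end RootArith

end NegB

end PlanarSkeletonNeg

end Summit.CriticalPhenomena.PercolationContinuityZ3.Theorems.Transplant
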